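import Literature.Analysis.FluidPDE.PlanarChainCover
import HarnessLib

/-!
# Junction agreement: closed forms of the element fields on gap regimes and their rational comparison

Topic `Literature/Analysis/FluidPDE`. Level-4 data model, part 5 (after `PlanarChainCover.lean`).
The transport of the move of a phase across a junction of two consecutive elements needs the two
element scalars AND the two element stream functions to coincide on the junction's agreement slab
(`PhaseQ.Agree`, `MovingChain.Agreement`). On a slab where both elements are in definite GAP
regimes of their profiles (the displacement profile `T` of a diagonal band, the material map `Ξ`)
both fields have closed forms:

* scalar `Θ = G((v - C(α) - W(α) u) / D(α))` with `(u, v)` the frame coordinates of the element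
  (integer linear forms of the lab point), `C, W` the gap intercept / slope of the line and `D` the
  gap slope of `Ξ`;
* stream function `H = clock' · (N_R(α, z) + K₂ N_K(α, z)) / Den(α)` with `N_R, N_K` polynomials
  of degree `≤ 2` in `z` whose coefficients are polynomials in `α` (products of the clock-affine
  data), `Den = det · D` (run) or `2 det · D` (diagonal band), and `K₂` the universal transition
  constant (`PlanarPwProfiles.K₂`, from the antiderivative of the displacement rate).

All of this is rational bookkeeping: polynomials in `α` with rational coefficients (`Poly`, Horner
evaluation), linear and quadratic forms in `z` with such coefficients (`Lin`, `ZP2`), the kink sums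
of the gap forms as folds over the kink list (`Pw.CgapP`, `DαCP`, `DαS`, `P0P`, `P2`, `PK`), the
closed forms (`scalar_closed`, `stream_closed`) and the **junction test** `agreeJB` comparing the
cross-multiplied closed forms of two elements as polynomial identities; its soundness
(`scalar_eq_of_agreeJB`, `stream_eq_of_agreeJB`) gives `MovingChain.Agreement` and the junction
agreement of the scalars for a phase all of whose junctions pass (`PhaseQ.agreement_of_agreeB`).

Folklore (polynomial identities); no named facts. Infrastructure towards a discharge of
`acm_compatible_blocks` (`QuasiSelfSimilarCompatibleBlocks.lean`).

## References

* G. Alberti, G. Crippa, A. L. Mazzucato, *Exponential self-similar mixing by incompressible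
  flows*, J. Amer. Math. Soc. 32 (2019), 445–490, §§7–8 (arXiv:1605.02090).
-/

noncomputable section

open Function Set Filter
open scoped Topology ContDiff

namespace Literature.Analysis.FluidPDE

namespace PlanarKinematics

open Gluing

/-- The plane `ℝ²` as a Euclidean space. [folklore] -/
local notation "E²" => EuclideanSpace ℝ (Fin 2)

/-! ## Polynomials in the clock value with rational coefficients -/

/-- **Rational polynomial** in one variable, as its coefficient list (low degree first). [folklore] -/
abbrev Poly := List ℚ

namespace Poly

/-- Horner evaluation at a real point. [folklore] -/
def eval : Poly → ℝ → ℝ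
  | [], _ => 0
  | c :: p, α => (c : ℝ) + α * eval p α

/-- Evaluation of the empty polynomial. [folklore] -/
@[simp] theorem eval_nil (α : ℝ) : eval [] α = 0 := rfl

/-- Evaluation of a cons. [folklore] -/
@[simp] theorem eval_cons (c : ℚ) (p : Poly) (α : ℝ) : eval (c :: p) α = (c : ℝ) + α * eval p α := rfl

/-- Constant polynomial. [folklore] -/
def C (c : ℚ) : Poly := [c]

/-- Evaluation of a constant. [folklore] -/
@[simp] theorem eval_C (c : ℚ) (α : ℝ) : eval (C c) α = c := by simp [C]

/-- Sum. [folklore] -/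
def add : Poly → Poly → Poly
  | [], q => q
  | p, [] => p
  | a :: p, b :: q => (a + b) :: add p q

/-- Evaluation of a sum. [folklore] -/
@[simp] theorem eval_add : ∀ (p q : Poly) (α : ℝ), eval (add p q) α = eval p α + eval q α
  | [], q, α => by simp [add]
  | a :: p, [], α => by simp [add]
  | a :: p, b :: q, α => by simp only [add, eval_cons, eval_add p q α]; push_cast; ring

/-- Scalar multiple. [folklore] -/
def smul (c : ℚ) (p : Poly) : Poly := p.map fun a => c * a

/-- Evaluation of a scalar multiple. [folklore] -/
@[simp] theorem eval_smul (c : ℚ) : ∀ (p : Poly) (α : ℝ), eval (smul c p) α = c * eval p α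
  | [], α => by simp [smul]
  | a :: p, α => by
    have := eval_smul c p α
    simp only [smul, List.map_cons, eval_cons] at this ⊢; rw [this, Rat.cast_mul]; ring

/-- Multiplication by the variable. [folklore] -/
def mulX (p : Poly) : Poly := 0 :: p

/-- Evaluation of `X · p`. [folklore] -/
@[simp] theorem eval_mulX (p : Poly) (α : ℝ) : eval (mulX p) α = α * eval p α := by simp [mulX]

/-- Product. [folklore] -/
def mul : Poly → Poly → Poly
  | [], _ => []
  | a :: p, q => add (smul a q) (mulX (mul p q))

/-- Evaluation of a product. [folklore] -/
@[simp] theorem eval_mul : ∀ (p q : Poly) (α : ℝ), eval (mul p q) α = eval p α * eval q α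
  | [], q, α => by simp [mul]
  | a :: p, q, α => by simp [mul, eval_mul p q α]; ring

/-- Negation. [folklore] -/
def neg (p : Poly) : Poly := smul (-1) p

/-- Evaluation of a negation. [folklore] -/
@[simp] theorem eval_neg (p : Poly) (α : ℝ) : eval (neg p) α = -eval p α := by simp [neg]

/-- Difference. [folklore] -/
def sub (p q : Poly) : Poly := add p (neg q)

/-- Evaluation of a difference. [folklore] -/
@[simp] theorem eval_sub (p q : Poly) (α : ℝ) : eval (sub p q) α = eval p α - eval q α := by simp [sub]; ring

/-- **Zero test** (all coefficients vanish). [folklore] -/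
def isZeroB (p : Poly) : Bool := p.all fun a => decide (a = 0)

/-- A polynomial passing the zero test evaluates to `0`. [folklore] -/
theorem eval_eq_zero_of_isZeroB : ∀ {p : Poly}, isZeroB p = true → ∀ α : ℝ, eval p α = 0
  | [], _, α => rfl
  | a :: p, h, α => by
    simp only [isZeroB, List.all_cons, Bool.and_eq_true, decide_eq_true_eq] at h
    rw [eval_cons, h.1, eval_eq_zero_of_isZeroB (p := p) h.2 α]; simp

/-- **Equality test**: the difference passes the zero test. [folklore] -/
def eqB (p q : Poly) : Bool := isZeroB (sub p q)

/-- Soundness of the equality test. [folklore] -/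
theorem eval_eq_of_eqB {p q : Poly} (h : eqB p q = true) (α : ℝ) : eval p α = eval q α := by
  have := eval_eq_zero_of_isZeroB h α; rw [eval_sub] at this; linarith

/-- A sum of polynomials over a list. [folklore] -/
def lsum {ι : Type*} (f : ι → Poly) : List ι → Poly
  | [] => []
  | i :: L => add (f i) (lsum f L)

/-- Evaluation of a list sum. [folklore] -/
@[simp] theorem eval_lsum {ι : Type*} (f : ι → Poly) (α : ℝ) : ∀ L : List ι, eval (lsum f L) α = (L.map fun i => eval (f i) α).sum
  | [] => by simp [lsum]
  | i :: L => by simp [lsum, eval_lsum f α L]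

end Poly

namespace Aff

/-- **Clock-affine data as a polynomial** `v0 + (v1 - v0) α`. [folklore] -/
def toPoly (a : Aff) : Poly := [a.v0, a.v1 - a.v0]

/-- Its evaluation is the evaluation of the affine datum. [folklore] -/
@[simp] theorem eval_toPoly (a : Aff) (α : ℝ) : Poly.eval a.toPoly α = a.eval α := by
  simp only [toPoly, Poly.eval_cons, Poly.eval_nil, Aff.eval]; push_cast; ring

/-- The rate as a rational number. [folklore] -/
def rateQ (a : Aff) : ℚ := a.v1 - a.v0

/-- The rational rate is the rate. [folklore] -/
@[simp] theorem cast_rateQ (a : Aff) : (a.rateQ : ℝ) = a.rate := by simp [rateQ, Aff.rate]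

end Aff

/-! ## Linear and quadratic forms in the lab point with polynomial coefficients -/

/-- **Linear form** `k₀(α) + k₁(α) z₀ + k₂(α) z₁`. [folklore] -/
structure Lin where
  /-- constant term -/
  k0 : Poly
  /-- coefficient of `z₀` -/
  k1 : Poly
  /-- coefficient of `z₁` -/
  k2 : Poly

namespace Lin

/-- Evaluation. [folklore] -/
def eval (L : Lin) (α : ℝ) (z : E²) : ℝ := L.k0.eval α + L.k1.eval α * z 0 + L.k2.eval α * z 1

/-- The integer linear form `a z₀ + b z₁`. [folklore] -/
def ofZ (a b : ℤ) : Lin := ⟨[], Poly.C a, Poly.C b⟩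

/-- Evaluation of an integer linear form. [folklore] -/
@[simp] theorem eval_ofZ (a b : ℤ) (α : ℝ) (z : E²) : (ofZ a b).eval α z = (a : ℝ) * z 0 + (b : ℝ) * z 1 := by
  simp [ofZ, eval]

/-- A polynomial as a constant linear form. [folklore] -/
def ofP (p : Poly) : Lin := ⟨p, [], []⟩

/-- Evaluation of a constant form. [folklore] -/
@[simp] theorem eval_ofP (p : Poly) (α : ℝ) (z : E²) : (ofP p).eval α z = p.eval α := by simp [ofP, eval]

/-- Sum. [folklore] -/
def add (L M : Lin) : Lin := ⟨Poly.add L.k0 M.k0, Poly.add L.k1 M.k1, Poly.add L.k2 M.k2⟩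

/-- Evaluation of a sum. [folklore] -/
@[simp] theorem eval_add (L M : Lin) (α : ℝ) (z : E²) : (L.add M).eval α z = L.eval α z + M.eval α z := by
  simp [add, eval]; ring

/-- Difference. [folklore] -/
def sub (L M : Lin) : Lin := ⟨Poly.sub L.k0 M.k0, Poly.sub L.k1 M.k1, Poly.sub L.k2 M.k2⟩

/-- Evaluation of a difference. [folklore] -/
@[simp] theorem eval_sub (L M : Lin) (α : ℝ) (z : E²) : (L.sub M).eval α z = L.eval α z - M.eval α z := by
  simp [sub, eval]; ring

/-- Multiplication by a polynomial. [folklore] -/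
def smulP (p : Poly) (L : Lin) : Lin := ⟨Poly.mul p L.k0, Poly.mul p L.k1, Poly.mul p L.k2⟩

/-- Evaluation of a polynomial multiple. [folklore] -/
@[simp] theorem eval_smulP (p : Poly) (L : Lin) (α : ℝ) (z : E²) : (smulP p L).eval α z = p.eval α * L.eval α z := by
  simp [smulP, eval]; ring

/-- **Equality test** (coefficientwise). [folklore] -/
def eqB (L M : Lin) : Bool := Poly.eqB L.k0 M.k0 && Poly.eqB L.k1 M.k1 && Poly.eqB L.k2 M.k2

/-- Soundness of the equality test. [folklore] -/
theorem eval_eq_of_eqB {L M : Lin} (h : eqB L M = true) (α : ℝ) (z : E²) : L.eval α z = M.eval α z := by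
  simp only [eqB, Bool.and_eq_true] at h
  simp only [eval, Poly.eval_eq_of_eqB h.1.1, Poly.eval_eq_of_eqB h.1.2, Poly.eval_eq_of_eqB h.2]

end Lin

/-- **Quadratic form** `Σ_{a+b ≤ 2} c_{ab}(α) z₀^a z₁^b`. [folklore] -/
structure ZP2 where
  /-- coefficient of `1` -/
  c00 : Poly
  /-- coefficient of `z₀` -/
  c10 : Poly
  /-- coefficient of `z₁` -/
  c01 : Poly
  /-- coefficient of `z₀²` -/
  c20 : Poly
  /-- coefficient of `z₀ z₁` -/
  c11 : Poly
  /-- coefficient of `z₁²` -/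
  c02 : Poly

namespace ZP2

/-- Evaluation. [folklore] -/
def eval (X : ZP2) (α : ℝ) (z : E²) : ℝ :=
  X.c00.eval α + X.c10.eval α * z 0 + X.c01.eval α * z 1 + X.c20.eval α * z 0 ^ 2 + X.c11.eval α * (z 0 * z 1) +
    X.c02.eval α * z 1 ^ 2

/-- A linear form as a quadratic form. [folklore] -/
def ofLin (L : Lin) : ZP2 := ⟨L.k0, L.k1, L.k2, [], [], []⟩

/-- Evaluation of an embedded linear form. [folklore] -/
@[simp] theorem eval_ofLin (L : Lin) (α : ℝ) (z : E²) : (ofLin L).eval α z = L.eval α z := by simp [ofLin, eval, Lin.eval]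

/-- Sum. [folklore] -/
def add (X Y : ZP2) : ZP2 :=
  ⟨Poly.add X.c00 Y.c00, Poly.add X.c10 Y.c10, Poly.add X.c01 Y.c01, Poly.add X.c20 Y.c20, Poly.add X.c11 Y.c11,
    Poly.add X.c02 Y.c02⟩

/-- Evaluation of a sum. [folklore] -/
@[simp] theorem eval_add (X Y : ZP2) (α : ℝ) (z : E²) : (X.add Y).eval α z = X.eval α z + Y.eval α z := by
  simp [add, eval]; ring

/-- Difference. [folklore] -/
def sub (X Y : ZP2) : ZP2 :=
  ⟨Poly.sub X.c00 Y.c00, Poly.sub X.c10 Y.c10, Poly.sub X.c01 Y.c01, Poly.sub X.c20 Y.c20, Poly.sub X.c11 Y.c11,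
    Poly.sub X.c02 Y.c02⟩

/-- Evaluation of a difference. [folklore] -/
@[simp] theorem eval_sub (X Y : ZP2) (α : ℝ) (z : E²) : (X.sub Y).eval α z = X.eval α z - Y.eval α z := by
  simp [sub, eval]; ring

/-- Multiplication by a polynomial. [folklore] -/
def smulP (p : Poly) (X : ZP2) : ZP2 :=
  ⟨Poly.mul p X.c00, Poly.mul p X.c10, Poly.mul p X.c01, Poly.mul p X.c20, Poly.mul p X.c11, Poly.mul p X.c02⟩

/-- Evaluation of a polynomial multiple. [folklore] -/
@[simp] theorem eval_smulP (p : Poly) (X : ZP2) (α : ℝ) (z : E²) : (smulP p X).eval α z = p.eval α * X.eval α z := by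
  simp [smulP, eval]; ring

/-- **Product of two linear forms.** [folklore] -/
def mulLin (L M : Lin) : ZP2 :=
  ⟨Poly.mul L.k0 M.k0, Poly.add (Poly.mul L.k0 M.k1) (Poly.mul L.k1 M.k0), Poly.add (Poly.mul L.k0 M.k2) (Poly.mul L.k2 M.k0),
    Poly.mul L.k1 M.k1, Poly.add (Poly.mul L.k1 M.k2) (Poly.mul L.k2 M.k1), Poly.mul L.k2 M.k2⟩

/-- Evaluation of a product of linear forms. [folklore] -/
@[simp] theorem eval_mulLin (L M : Lin) (α : ℝ) (z : E²) : (mulLin L M).eval α z = L.eval α z * M.eval α z := by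
  simp [mulLin, eval, Lin.eval]; ring

/-- **Equality test** (coefficientwise). [folklore] -/
def eqB (X Y : ZP2) : Bool :=
  Poly.eqB X.c00 Y.c00 && Poly.eqB X.c10 Y.c10 && Poly.eqB X.c01 Y.c01 && Poly.eqB X.c20 Y.c20 && Poly.eqB X.c11 Y.c11 &&
    Poly.eqB X.c02 Y.c02

/-- Soundness of the equality test. [folklore] -/
theorem eval_eq_of_eqB {X Y : ZP2} (h : eqB X Y = true) (α : ℝ) (z : E²) : X.eval α z = Y.eval α z := by
  simp only [eqB, Bool.and_eq_true] at h
  obtain ⟨⟨⟨⟨⟨h1, h2⟩, h3⟩, h4⟩, h5⟩, h6⟩ := h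
  simp only [eval, Poly.eval_eq_of_eqB h1, Poly.eval_eq_of_eqB h2, Poly.eval_eq_of_eqB h3, Poly.eval_eq_of_eqB h4,
    Poly.eval_eq_of_eqB h5, Poly.eval_eq_of_eqB h6]

end ZP2

/-! ## Kink sums of the gap forms as polynomials -/

namespace Kink

/-- `J (b + ℓ/2)` as a polynomial. [folklore] -/
def cgapTermP (k : Kink) : Poly := Poly.mul k.J.toPoly (Poly.add k.b.toPoly (Poly.C (k.ℓ / 2)))

/-- Its evaluation. [folklore] -/
@[simp] theorem eval_cgapTermP (k : Kink) (α : ℝ) :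
    Poly.eval k.cgapTermP α = k.J.eval α * (k.b.eval α + (k.ℓ : ℝ) / 2) := by
  simp only [cgapTermP, Poly.eval_mul, Poly.eval_add, Aff.eval_toPoly, Poly.eval_C]; push_cast; ring

/-- `J' (b + ℓ/2) + J b'` as a polynomial (the kink terms of the gap rate intercept). [folklore] -/
def dαTermP (k : Kink) : Poly :=
  Poly.add (Poly.smul k.J.rateQ (Poly.add k.b.toPoly (Poly.C (k.ℓ / 2)))) (Poly.smul k.b.rateQ k.J.toPoly)

/-- Its evaluation. [folklore] -/
@[simp] theorem eval_dαTermP (k : Kink) (α : ℝ) :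
    Poly.eval k.dαTermP α = k.J.rate * (k.b.eval α + (k.ℓ : ℝ) / 2) + k.J.eval α * k.b.rate := by
  simp only [dαTermP, Poly.eval_add, Poly.eval_smul, Aff.eval_toPoly, Poly.eval_C]
  push_cast
  rw [Aff.cast_rateQ, Aff.cast_rateQ]; ring

/-- `J' (b + ℓ/2)²/2 + J b' (b + ℓ/2)` as a polynomial (the kink terms of the constant coefficient of
the gap antiderivative). [folklore] -/
def p0TermP (k : Kink) : Poly :=
  let B := Poly.add k.b.toPoly (Poly.C (k.ℓ / 2))
  Poly.add (Poly.smul (k.J.rateQ / 2) (Poly.mul B B)) (Poly.smul k.b.rateQ (Poly.mul k.J.toPoly B))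

/-- Its evaluation. [folklore] -/
@[simp] theorem eval_p0TermP (k : Kink) (α : ℝ) :
    Poly.eval k.p0TermP α = k.J.rate * (k.b.eval α + (k.ℓ : ℝ) / 2) ^ 2 / 2 +
      k.J.eval α * k.b.rate * (k.b.eval α + (k.ℓ : ℝ) / 2) := by
  simp only [p0TermP, Poly.eval_add, Poly.eval_smul, Poly.eval_mul, Aff.eval_toPoly, Poly.eval_C]
  push_cast
  rw [Aff.cast_rateQ, Aff.cast_rateQ]; ring

end Kink

namespace Pw

variable (F : Pw)

/-- **Gap slope as a polynomial.** [folklore] -/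
def WP (F : Pw) (m : ℕ) : Poly := (F.WAff m).toPoly

/-- Its evaluation. [folklore] -/
@[simp] theorem eval_WP (m : ℕ) (α : ℝ) : Poly.eval (F.WP m) α = F.W m α := by rw [WP, Aff.eval_toPoly, F.eval_WAff]

/-- **Gap intercept as a polynomial** `c - Σ_{i<m} Jᵢ (bᵢ + ℓᵢ/2)`. [folklore] -/
def CgapP (F : Pw) (m : ℕ) : Poly := Poly.sub F.c.toPoly (Poly.lsum Kink.cgapTermP (F.kinks.take m))

/-- Its evaluation is the gap intercept. [folklore] -/
@[simp] theorem eval_CgapP (m : ℕ) (α : ℝ) : Poly.eval (F.CgapP m) α = F.Cgap m α := by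
  simp [CgapP, Pw.Cgap]

/-- **Gap rate slope** `s' + Σ_{i<m} Jᵢ'` (a rational number). [folklore] -/
def DαS (F : Pw) (m : ℕ) : ℚ := F.s.rateQ + ((F.kinks.take m).map fun k => k.J.rateQ).sum

/-- **Gap rate intercept as a polynomial** `c' - Σ_{i<m} (Jᵢ' (bᵢ + ℓᵢ/2) + Jᵢ bᵢ')`. [folklore] -/
def DαCP (F : Pw) (m : ℕ) : Poly := Poly.sub (Poly.C F.c.rateQ) (Poly.lsum Kink.dαTermP (F.kinks.take m))

/-- Cast of the rational slope sum. [folklore] -/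
theorem cast_DαS (m : ℕ) : (F.DαS m : ℝ) = F.s.rate + ((F.kinks.take m).map fun k => k.J.rate).sum := by
  simp only [DαS, Rat.cast_add, Aff.cast_rateQ, Rat.cast_list_sum, List.map_map, Function.comp_def]

/-- The kink sum of the gap rate, rearranged. [folklore] -/
theorem sum_gapDα_terms (L : List Kink) (α u : ℝ) :
    (L.map fun k => k.J.rate * (u - k.b.eval α - (k.ℓ : ℝ) / 2) - k.J.eval α * k.b.rate).sum =
      (L.map fun k => k.J.rate).sum * u -
        (L.map fun k => k.J.rate * (k.b.eval α + (k.ℓ : ℝ) / 2) + k.J.eval α * k.b.rate).sum := by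
  induction L with
  | nil => simp
  | cons k L ih => simp only [List.map_cons, List.sum_cons, ih]; ring

/-- **The gap rate is `DαC + DαS u`.** [folklore] -/
theorem gapDα_eq (m : ℕ) (α u : ℝ) : F.gapDα m α u = Poly.eval (F.DαCP m) α + (F.DαS m : ℝ) * u := by
  rw [Pw.gapDα, sum_gapDα_terms, cast_DαS]
  simp only [DαCP, Poly.eval_sub, Poly.eval_C, Aff.cast_rateQ, Poly.eval_lsum, Kink.eval_dαTermP]
  ring

/-- **Quadratic coefficient of the gap antiderivative** `s'/2 + Σ Jᵢ'/2`. [folklore] -/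
def P2 (F : Pw) (m : ℕ) : ℚ := F.DαS m / 2

/-- **Constant coefficient of the gap antiderivative as a polynomial**
`Σ_{i<m} (Jᵢ' (bᵢ + ℓᵢ/2)²/2 + Jᵢ bᵢ' (bᵢ + ℓᵢ/2))`. [folklore] -/
def P0P (F : Pw) (m : ℕ) : Poly := Poly.lsum Kink.p0TermP (F.kinks.take m)

/-- **`K₂`-coefficient of the gap antiderivative** `Σ_{i<m} Jᵢ' ℓᵢ²`. [folklore] -/
def PK (F : Pw) (m : ℕ) : ℚ := ((F.kinks.take m).map fun k => k.J.rateQ * k.ℓ ^ 2).sum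

/-- Cast of the `K₂`-coefficient. [folklore] -/
theorem cast_PK (m : ℕ) : (F.PK m : ℝ) = ((F.kinks.take m).map fun k => k.J.rate * (k.ℓ : ℝ) ^ 2).sum := by
  simp only [PK, Rat.cast_list_sum, List.map_map, Function.comp_def, Rat.cast_mul, Rat.cast_pow, Aff.cast_rateQ]

/-- Cast of the quadratic coefficient. [folklore] -/
theorem cast_P2 (m : ℕ) : (F.P2 m : ℝ) = (F.s.rate + ((F.kinks.take m).map fun k => k.J.rate).sum) / 2 := by
  rw [P2, Rat.cast_div, cast_DαS]; norm_num

/-- The kink sum of the gap antiderivative, rearranged. [folklore] -/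
theorem sum_gapDαPrim_terms (L : List Kink) (α u : ℝ) :
    (L.map fun k => k.J.rate * ((u - k.b.eval α - (k.ℓ : ℝ) / 2) ^ 2 / 2 + (k.ℓ : ℝ) ^ 2 * K₂) -
        k.J.eval α * k.b.rate * (u - k.b.eval α - (k.ℓ : ℝ) / 2)).sum =
      K₂ * (L.map fun k => k.J.rate * (k.ℓ : ℝ) ^ 2).sum +
        (L.map fun k => k.J.rate * (k.b.eval α + (k.ℓ : ℝ) / 2) ^ 2 / 2 + k.J.eval α * k.b.rate * (k.b.eval α + (k.ℓ : ℝ) / 2)).sum -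
        (L.map fun k => k.J.rate * (k.b.eval α + (k.ℓ : ℝ) / 2) + k.J.eval α * k.b.rate).sum * u +
        (L.map fun k => k.J.rate).sum / 2 * u ^ 2 := by
  induction L with
  | nil => simp
  | cons k L ih => simp only [List.map_cons, List.sum_cons, ih]; ring

/-- **The gap antiderivative is `K₂ PK + P0 + DαC u + P2 u²`.** [folklore] -/
theorem gapDαPrim_eq (m : ℕ) (α u : ℝ) :
    F.gapDαPrim m α u = K₂ * (F.PK m : ℝ) + Poly.eval (F.P0P m) α + Poly.eval (F.DαCP m) α * u + (F.P2 m : ℝ) * u ^ 2 := by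
  rw [Pw.gapDαPrim, sum_gapDαPrim_terms, cast_PK, cast_P2]
  simp only [P0P, DαCP, Poly.eval_sub, Poly.eval_C, Aff.cast_rateQ, Poly.eval_lsum, Kink.eval_p0TermP, Kink.eval_dαTermP]
  ring

end Pw

/-! ## Closed forms of the element scalar on gap regimes -/

namespace ElemQ

variable (e : ElemQ)

/-- The frame abscissa as a linear form. [folklore] -/
def uLin (e : ElemQ) : Lin := Lin.ofZ e.uC.1 e.uC.2

/-- The frame ordinate as a linear form. [folklore] -/
def vLin (e : ElemQ) : Lin := Lin.ofZ e.vC.1 e.vC.2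

/-- Evaluation of the abscissa form. [folklore] -/
@[simp] theorem eval_uLin (α : ℝ) (z : E²) : e.uLin.eval α z = e.uOf z := by simp [uLin, uOf]

/-- Evaluation of the ordinate form. [folklore] -/
@[simp] theorem eval_vLin (α : ℝ) (z : E²) : e.vLin.eval α z = e.vOf z := by simp [vLin, vOf]

/-- **The scalar in frame coordinates.** [folklore] -/
theorem scalar_frame (t₀ τ : ℝ) (G : ℝ → ℝ) (t : ℝ) (z : E²) :
    e.scalar t₀ τ G t z = G ((e.vOf z - e.line (clock t₀ τ t) (e.uOf z)) / e.xi.du (clock t₀ τ t) (e.uOf z)) := by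
  cases e with
  | run r => simp [ElemQ.scalar, RunQ.scalar, LinFrame.conjScalar_apply, runScalar_apply, vOf_run, uOf_run, line, RunQ.yF, xi, Pw.cdu]
  | dg d => simp [ElemQ.scalar, DgQ.scalar, LinFrame.conjScalar_apply, cornerScalar_apply, vOf_dg, uOf_dg, line, Pw.cval, xi,
      Pw.cdu, diagFrame_apply, vec2_apply_zero, vec2_apply_one]

/-- **Line intercept polynomial** on a regime: `y` (run), the gap intercept of `T` (diagonal band, gap `mT`). [folklore] -/
def lineCP (e : ElemQ) (mT : ℕ) : Poly :=
  match e with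
  | run r => r.y.toPoly
  | dg d => d.T.CgapP mT

/-- **Line slope polynomial** on a regime: `0` (run), the gap slope of `T` (diagonal band). [folklore] -/
def lineWP (e : ElemQ) (mT : ℕ) : Poly :=
  match e with
  | run _ => []
  | dg d => d.T.WP mT

/-- Regime hypothesis for the line: trivial for a run, gap `mT` of `T` for a diagonal band. [folklore] -/
def LineGap (e : ElemQ) (mT : ℕ) (α u : ℝ) : Prop :=
  match e with
  | run _ => True
  | dg d => d.T.InGap mT α u

/-- **The line on its gap regime.** [folklore] -/
theorem line_eq_of_lineGap (hv : e.validB = true) {mT : ℕ} {α u : ℝ} (h : e.LineGap mT α u) :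
    e.line α u = Poly.eval (e.lineCP mT) α + Poly.eval (e.lineWP mT) α * u := by
  cases e with
  | run r => simp [line, lineCP, lineWP]
  | dg d =>
    have hT : d.T.LenPos := DgQ.lenPosT_of_validB hv
    simp only [line, lineCP, lineWP, Pw.eval_CgapP, Pw.eval_WP]
    rw [d.T.val_eq_gapVal hT h, d.T.gapVal_eq]

/-- **Numerator of the scalar argument** `v - C - W u` as a linear form. [folklore] -/
def argNum (e : ElemQ) (mT : ℕ) : Lin :=
  e.vLin.sub ((Lin.ofP (e.lineCP mT)).add (Lin.smulP (e.lineWP mT) e.uLin))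

/-- **Denominator of the scalar argument**: the gap slope of `Ξ`. [folklore] -/
def argDen (e : ElemQ) (mΞ : ℕ) : Poly := e.xi.WP mΞ

/-- **Closed form of the scalar** on the regimes. [folklore] -/
theorem scalar_closed (hv : e.validB = true) {t₀ τ : ℝ} (G : ℝ → ℝ) {t : ℝ} {z : E²} {mT mΞ : ℕ}
    (hT : e.LineGap mT (clock t₀ τ t) (e.uOf z)) (hΞ : e.xi.InGap mΞ (clock t₀ τ t) (e.uOf z)) :
    e.scalar t₀ τ G t z = G ((e.argNum mT).eval (clock t₀ τ t) z / Poly.eval (e.argDen mΞ) (clock t₀ τ t)) := by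
  have hF : e.xi.LenPos := Pw.lenPos_of_matValidB (e.matValid_of_validB hv)
  rw [e.scalar_frame, e.line_eq_of_lineGap hv hT, e.xi.du_eq_W hF hΞ]
  simp [argNum, argDen]

/-- **The gap slope of a valid material map is positive.** [folklore] -/
theorem argDen_pos (hv : e.validB = true) {α : ℝ} (hα : α ∈ Icc (0 : ℝ) 1) {mΞ : ℕ} (hm : mΞ ≤ e.xi.kinks.length) :
    0 < Poly.eval (e.argDen mΞ) α := by
  have hmv := e.matValid_of_validB hv
  simp only [Pw.matValidB, Bool.and_eq_true, decide_eq_true_eq] at hmv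
  rw [argDen, Pw.eval_WP]
  have h1 := (e.xi.W_mem_of_slopesInB hmv.1.2 hα mΞ hm).1
  have h2 : (0 : ℝ) < e.wlo := by exact_mod_cast hmv.2
  linarith

end ElemQ

/-! ## Closed forms of the element stream function on gap regimes -/

namespace ElemQ

variable (e : ElemQ)

/-- **Material rate form** `DαC(α) + DαS u` of `Ξ` on gap `mΞ`, as a linear form. [folklore] -/
def rateLin (e : ElemQ) (mΞ : ℕ) : Lin := (Lin.ofP (e.xi.DαCP mΞ)).add (Lin.smulP (Poly.C (e.xi.DαS mΞ)) e.uLin)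

/-- **Stream denominator** `det · W` (run) or `2 det · W` (diagonal band). [folklore] -/
def strDen (e : ElemQ) (mΞ : ℕ) : Poly :=
  match e with
  | run r => Poly.smul (run r).detQ (r.Ξ.WP mΞ)
  | dg d => Poly.smul (2 * (dg d).detQ) (d.Ξ.WP mΞ)

/-- The stream offset data. [folklore] -/
def cR : ElemQ → Aff
  | run r => r.cR
  | dg d => d.cR

/-- The stream offset data (`K₂` part). [folklore] -/
def cK : ElemQ → Aff
  | run r => r.cK
  | dg d => d.cK

/-- **Rational numerator of the stream function** on the regimes. [folklore] -/
def strNumR (e : ElemQ) (mT mΞ : ℕ) : ZP2 :=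
  let core := ZP2.smulP (Poly.C (-1)) (ZP2.mulLin (e.rateLin mΞ) (e.argNum mT))
  let off := ZP2.ofLin (Lin.ofP (Poly.mul (e.strDen mΞ) e.cR.toPoly))
  match e with
  | run r => (core.add (ZP2.ofLin (Lin.smulP (Poly.smul (-r.y.rateQ) (r.Ξ.WP mΞ)) (run r).uLin))).add off
  | dg d => (core.sub (ZP2.smulP (d.Ξ.WP mΞ)
      ((ZP2.ofLin ((Lin.ofP (d.T.P0P mT)).add (Lin.smulP (d.T.DαCP mT) (dg d).uLin))).add
        (ZP2.smulP (Poly.C (d.T.P2 mT)) (ZP2.mulLin (dg d).uLin (dg d).uLin))))).add off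

/-- **`K₂` numerator of the stream function** on the regimes. [folklore] -/
def strNumK (e : ElemQ) (mT mΞ : ℕ) : ZP2 :=
  let off := Poly.mul (e.strDen mΞ) e.cK.toPoly
  match e with
  | run _ => ZP2.ofLin (Lin.ofP off)
  | dg d => ZP2.ofLin (Lin.ofP (Poly.add (Poly.smul (-(d.T.PK mT)) (d.Ξ.WP mΞ)) off))

/-- Evaluation of the rate form. [folklore] -/
theorem eval_rateLin (mΞ : ℕ) (α : ℝ) (z : E²) :
    (e.rateLin mΞ).eval α z = Poly.eval (e.xi.DαCP mΞ) α + (e.xi.DαS mΞ : ℝ) * e.uOf z := by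
  simp [rateLin]

/-- **Closed form of the stream function of a run** on gap `mΞ` of `Ξ`. [folklore] -/
theorem stream_closed_run (r : RunQ) (hv : (run r).validB = true) {t₀ τ t : ℝ} {z : E²} {mT mΞ : ℕ}
    (hΞ : r.Ξ.InGap mΞ (clock t₀ τ t) ((run r).uOf z)) (hm : mΞ ≤ r.Ξ.kinks.length) :
    (run r).stream t₀ τ t z = clockDeriv t₀ τ t *
      ((((run r).strNumR mT mΞ).eval (clock t₀ τ t) z + K₂ * ((run r).strNumK mT mΞ).eval (clock t₀ τ t) z) /
        Poly.eval ((run r).strDen mΞ) (clock t₀ τ t)) := by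
  set α := clock t₀ τ t with hα
  have hF : r.Ξ.LenPos := Pw.lenPos_of_matValidB ((run r).matValid_of_validB hv)
  have hW : 0 < r.Ξ.W mΞ α := by
    have := (run r).argDen_pos hv (clock_mem_Icc t₀ τ t) (mΞ := mΞ) hm
    rwa [argDen, xi, Pw.eval_WP] at this
  have hdet : ((run r).detQ : ℝ) ≠ 0 := (run r).detQ_ne_zero
  have hu : ((d4Frame r.o).app z) 0 = (run r).uOf z := (uOf_run r z).symm
  have hvv : ((d4Frame r.o).app z) 1 = (run r).vOf z := (vOf_run r z).symm
  have hdu : r.Ξ.du α ((run r).uOf z) = r.Ξ.W mΞ α := r.Ξ.du_eq_W hF hΞ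
  have hdα : r.Ξ.dα α ((run r).uOf z) = Poly.eval (r.Ξ.DαCP mΞ) α + (r.Ξ.DαS mΞ : ℝ) * (run r).uOf z := by
    rw [r.Ξ.dα_eq_gapDα hF hΞ, r.Ξ.gapDα_eq]
  have hdetR : (d4Frame r.o).det = ((run r).detQ : ℝ) := by rw [(run r).detQ_cast]; rfl
  simp only [ElemQ.stream, RunQ.stream, LinFrame.conjStream_apply, runStream, graphStream, axialRate, RunQ.yF, RunQ.y'F,
    Pw.cdu, Pw.cdt, streamOffset, hu, hvv, ← hα, hdu, hdα, hdetR]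
  simp only [strNumR, strNumK, strDen, ZP2.eval_add, ZP2.eval_smulP, ZP2.eval_mulLin, ZP2.eval_ofLin, Lin.eval_ofP,
    Lin.eval_smulP, eval_rateLin, Poly.eval_C, Poly.eval_mul, Poly.eval_smul, Pw.eval_WP, Aff.eval_toPoly, eval_uLin,
    eval_vLin, argNum, lineCP, lineWP, Lin.eval_sub, Lin.eval_add, xi, ElemQ.cR, ElemQ.cK, Poly.eval_nil]
  push_cast
  rw [Aff.cast_rateQ]
  field_simp
  ring

/-- **Closed form of the stream function of a diagonal band** on gap `mT` of `T` and gap `mΞ` of `Ξ`. [folklore] -/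
theorem stream_closed_dg (d : DgQ) (hv : (dg d).validB = true) {t₀ τ t : ℝ} {z : E²} {mT mΞ : ℕ}
    (hT : d.T.InGap mT (clock t₀ τ t) ((dg d).uOf z)) (hΞ : d.Ξ.InGap mΞ (clock t₀ τ t) ((dg d).uOf z))
    (hm : mΞ ≤ d.Ξ.kinks.length) :
    (dg d).stream t₀ τ t z = clockDeriv t₀ τ t *
      ((((dg d).strNumR mT mΞ).eval (clock t₀ τ t) z + K₂ * ((dg d).strNumK mT mΞ).eval (clock t₀ τ t) z) /
        Poly.eval ((dg d).strDen mΞ) (clock t₀ τ t)) := by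
  set α := clock t₀ τ t with hα
  have hF : d.Ξ.LenPos := Pw.lenPos_of_matValidB ((dg d).matValid_of_validB hv)
  have hFT : d.T.LenPos := DgQ.lenPosT_of_validB hv
  have hW : 0 < d.Ξ.W mΞ α := by
    have := (dg d).argDen_pos hv (clock_mem_Icc t₀ τ t) (mΞ := mΞ) hm
    rwa [argDen, xi, Pw.eval_WP] at this
  have hdet : ((dg d).detQ : ℝ) ≠ 0 := (dg d).detQ_ne_zero
  have hu : (diagFrame ((d4Frame d.o).app z)) 0 = (dg d).uOf z := (uOf_dg d z).symm
  have hvv : (diagFrame ((d4Frame d.o).app z)) 1 = (dg d).vOf z := (vOf_dg d z).symm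
  have hdu : d.Ξ.du α ((dg d).uOf z) = d.Ξ.W mΞ α := d.Ξ.du_eq_W hF hΞ
  have hdα : d.Ξ.dα α ((dg d).uOf z) = Poly.eval (d.Ξ.DαCP mΞ) α + (d.Ξ.DαS mΞ : ℝ) * (dg d).uOf z := by
    rw [d.Ξ.dα_eq_gapDα hF hΞ, d.Ξ.gapDα_eq]
  have hTv : d.T.val α ((dg d).uOf z) = Poly.eval (d.T.CgapP mT) α + Poly.eval (d.T.WP mT) α * (dg d).uOf z := by
    rw [d.T.val_eq_gapVal hFT hT, d.T.gapVal_eq, Pw.eval_CgapP, Pw.eval_WP]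
  have hTp : d.T.dαPrim α ((dg d).uOf z) = K₂ * (d.T.PK mT : ℝ) + Poly.eval (d.T.P0P mT) α +
      Poly.eval (d.T.DαCP mT) α * (dg d).uOf z + (d.T.P2 mT : ℝ) * (dg d).uOf z ^ 2 := by
    rw [d.T.dαPrim_eq_gapDαPrim hFT hT, d.T.gapDαPrim_eq]
  have hdetR : (d4Frame d.o).det = ((dg d).detQ : ℝ) := by rw [(dg d).detQ_cast]; rfl
  simp only [ElemQ.stream, DgQ.stream, LinFrame.conjStream_apply, cornerStream, graphStream, DgQ.g, axialRate, Pw.cval,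
    Pw.cdu, Pw.cdt, Pw.cprim, streamOffset, hu, hvv, ← hα, hdu, hdα, hTv, hTp, hdetR]
  simp only [strNumR, strNumK, strDen, ZP2.eval_add, ZP2.eval_sub, ZP2.eval_smulP, ZP2.eval_mulLin, ZP2.eval_ofLin,
    Lin.eval_ofP, Lin.eval_smulP, eval_rateLin, Poly.eval_C, Poly.eval_mul, Poly.eval_smul, Poly.eval_add, Pw.eval_WP,
    Pw.eval_CgapP, Aff.eval_toPoly, eval_uLin, eval_vLin, argNum, lineCP, lineWP, Lin.eval_sub, Lin.eval_add, xi,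
    ElemQ.cR, ElemQ.cK]
  push_cast
  field_simp
  ring

/-- **Closed form of the stream function** on the regimes. [folklore] -/
theorem stream_closed (hv : e.validB = true) {t₀ τ t : ℝ} {z : E²} {mT mΞ : ℕ}
    (hT : e.LineGap mT (clock t₀ τ t) (e.uOf z)) (hΞ : e.xi.InGap mΞ (clock t₀ τ t) (e.uOf z))
    (hm : mΞ ≤ e.xi.kinks.length) :
    e.stream t₀ τ t z = clockDeriv t₀ τ t *
      (((e.strNumR mT mΞ).eval (clock t₀ τ t) z + K₂ * (e.strNumK mT mΞ).eval (clock t₀ τ t) z) /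
        Poly.eval (e.strDen mΞ) (clock t₀ τ t)) := by
  cases e with
  | run r => exact stream_closed_run r hv hΞ hm
  | dg d => exact stream_closed_dg d hv hT hΞ hm

/-- **The stream denominator of a valid element does not vanish** on `[0,1]`. [folklore] -/
theorem strDen_ne_zero (hv : e.validB = true) {α : ℝ} (hα : α ∈ Icc (0 : ℝ) 1) {mΞ : ℕ} (hm : mΞ ≤ e.xi.kinks.length) :
    Poly.eval (e.strDen mΞ) α ≠ 0 := by
  have hW := e.argDen_pos hv hα hm
  rw [argDen, Pw.eval_WP] at hW
  have hdet := e.detQ_ne_zero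
  cases e with
  | run r =>
    simp only [strDen, Poly.eval_smul, Pw.eval_WP, xi] at hW ⊢
    exact mul_ne_zero hdet hW.ne'
  | dg d =>
    simp only [strDen, Poly.eval_smul, Pw.eval_WP, xi] at hW ⊢
    push_cast
    exact mul_ne_zero (mul_ne_zero two_ne_zero hdet) hW.ne'

/-! ## The junction test -/

/-- The profile regime of the line on gap `mT` (`flat` for a run: no condition). [folklore] -/
def lineReg (e : ElemQ) (mT : ℕ) : RegQ :=
  match e with
  | run _ => .flat
  | dg _ => .gap mT

/-- Line regime validity on an interval gives the line gap hypothesis inside. [folklore] -/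
theorem lineGap_of_regOK {mT : ℕ} {α ua ub : ℝ} (h : e.RegOK (e.lineReg mT) α ua ub) {u : ℝ} (hu : u ∈ Icc ua ub) :
    e.LineGap mT α u := by
  cases e with
  | run r => trivial
  | dg d => exact d.T.inGap_of_regOK h hu

/-- **One-sided junction data check** for element `e` on `[za, zb]` with regimes `(mT, mΞ)`: the line
regime and the material gap are valid on the interval, and `mΞ` is a gap index. [folklore] -/
def sideOKB (e : ElemQ) (mT mΞ : ℕ) (za zb : Aff) : Bool :=
  e.regOKB (e.lineReg mT) za zb && e.xi.regOKB (.gap mΞ) za zb && decide (mΞ ≤ e.xi.kinks.length)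

/-- **Junction test** of two elements: both sides valid, the cross-multiplied closed forms of the
scalar arguments coincide UP TO SIGN (the profile `G` is even; the transverse orientations of the two
frames need not match), and those of the two stream numerators coincide, as polynomial identities. [folklore] -/
def agreeJB (e e' : ElemQ) (mT mΞ mT' mΞ' : ℕ) (za zb za' zb' : Aff) : Bool :=
  e.sideOKB mT mΞ za zb && e'.sideOKB mT' mΞ' za' zb' &&
    (Lin.eqB (Lin.smulP (e'.argDen mΞ') (e.argNum mT)) (Lin.smulP (e.argDen mΞ) (e'.argNum mT')) ||
      Lin.eqB (Lin.smulP (e'.argDen mΞ') (e.argNum mT)) (Lin.smulP (Poly.neg (e.argDen mΞ)) (e'.argNum mT'))) &&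
    ZP2.eqB (ZP2.smulP (e'.strDen mΞ') (e.strNumR mT mΞ)) (ZP2.smulP (e.strDen mΞ) (e'.strNumR mT' mΞ')) &&
    ZP2.eqB (ZP2.smulP (e'.strDen mΞ') (e.strNumK mT mΞ)) (ZP2.smulP (e.strDen mΞ) (e'.strNumK mT' mΞ'))

variable {e}

/-- **Soundness of the junction test, scalars**: at a time of a common clock and a point whose
abscissae lie in the two intervals, the two element scalars coincide. [folklore] -/
theorem scalar_eq_of_agreeJB {e' : ElemQ} {mT mΞ mT' mΞ' : ℕ} {za zb za' zb' : Aff}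
    (h : agreeJB e e' mT mΞ mT' mΞ' za zb za' zb' = true) (hv : e.validB = true) (hv' : e'.validB = true)
    {t₀ τ : ℝ} {G : ℝ → ℝ} (hGe : ∀ x, G (-x) = G x) {t : ℝ} {z : E²}
    (hu : e.uOf z ∈ Icc (za.eval (clock t₀ τ t)) (zb.eval (clock t₀ τ t)))
    (hu' : e'.uOf z ∈ Icc (za'.eval (clock t₀ τ t)) (zb'.eval (clock t₀ τ t))) :
    e.scalar t₀ τ G t z = e'.scalar t₀ τ G t z := by
  set α := clock t₀ τ t with hα
  have hαI : α ∈ Icc (0 : ℝ) 1 := clock_mem_Icc t₀ τ t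
  simp only [agreeJB, sideOKB, Bool.and_eq_true, decide_eq_true_eq] at h
  obtain ⟨⟨⟨⟨⟨⟨hl, hx⟩, hm⟩, ⟨⟨hl', hx'⟩, hm'⟩⟩, hsc⟩, _⟩, _⟩ := h
  have hT : e.LineGap mT α (e.uOf z) := e.lineGap_of_regOK (e.regOK_of_regOKB hl hαI) hu
  have hT' : e'.LineGap mT' α (e'.uOf z) := e'.lineGap_of_regOK (e'.regOK_of_regOKB hl' hαI) hu'
  have hΞ : e.xi.InGap mΞ α (e.uOf z) := e.xi.inGap_of_regOK (e.xi.regOK_of_regOKB (reg := .gap mΞ) hx hαI) hu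
  have hΞ' : e'.xi.InGap mΞ' α (e'.uOf z) := e'.xi.inGap_of_regOK (e'.xi.regOK_of_regOKB (reg := .gap mΞ') hx' hαI) hu'
  rw [e.scalar_closed hv G hT hΞ, e'.scalar_closed hv' G hT' hΞ']
  have hD := e.argDen_pos hv hαI hm
  have hD' := e'.argDen_pos hv' hαI hm'
  simp only [Bool.or_eq_true] at hsc
  rcases hsc with hsc | hsc
  · congr 1
    have key := Lin.eval_eq_of_eqB hsc α z
    simp only [Lin.eval_smulP] at key
    rw [div_eq_div_iff hD.ne' hD'.ne']
    linarith
  · have key := Lin.eval_eq_of_eqB hsc α z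
    simp only [Lin.eval_smulP, Poly.eval_neg] at key
    rw [← hGe, ← neg_div]
    congr 1
    rw [div_eq_div_iff hD.ne' hD'.ne']
    linarith

/-- **Soundness of the junction test, stream functions.** [folklore] -/
theorem stream_eq_of_agreeJB {e' : ElemQ} {mT mΞ mT' mΞ' : ℕ} {za zb za' zb' : Aff}
    (h : agreeJB e e' mT mΞ mT' mΞ' za zb za' zb' = true) (hv : e.validB = true) (hv' : e'.validB = true)
    {t₀ τ t : ℝ} {z : E²}
    (hu : e.uOf z ∈ Icc (za.eval (clock t₀ τ t)) (zb.eval (clock t₀ τ t)))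
    (hu' : e'.uOf z ∈ Icc (za'.eval (clock t₀ τ t)) (zb'.eval (clock t₀ τ t))) :
    e.stream t₀ τ t z = e'.stream t₀ τ t z := by
  set α := clock t₀ τ t with hα
  have hαI : α ∈ Icc (0 : ℝ) 1 := clock_mem_Icc t₀ τ t
  simp only [agreeJB, sideOKB, Bool.and_eq_true, decide_eq_true_eq] at h
  obtain ⟨⟨⟨⟨⟨⟨hl, hx⟩, hm⟩, ⟨⟨hl', hx'⟩, hm'⟩⟩, _⟩, hR⟩, hK⟩ := h
  have hT : e.LineGap mT α (e.uOf z) := e.lineGap_of_regOK (e.regOK_of_regOKB hl hαI) hu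
  have hT' : e'.LineGap mT' α (e'.uOf z) := e'.lineGap_of_regOK (e'.regOK_of_regOKB hl' hαI) hu'
  have hΞ : e.xi.InGap mΞ α (e.uOf z) := e.xi.inGap_of_regOK (e.xi.regOK_of_regOKB (reg := .gap mΞ) hx hαI) hu
  have hΞ' : e'.xi.InGap mΞ' α (e'.uOf z) := e'.xi.inGap_of_regOK (e'.xi.regOK_of_regOKB (reg := .gap mΞ') hx' hαI) hu'
  rw [e.stream_closed hv hT hΞ hm, e'.stream_closed hv' hT' hΞ' hm']
  congr 1
  have hD := e.strDen_ne_zero hv hαI hm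
  have hD' := e'.strDen_ne_zero hv' hαI hm'
  have kR := ZP2.eval_eq_of_eqB hR α z
  have kK := ZP2.eval_eq_of_eqB hK α z
  simp only [ZP2.eval_smulP] at kR kK
  rw [div_eq_div_iff hD hD']
  linear_combination kR + K₂ * kK

end ElemQ

/-! ## Agreement of a phase -/

namespace PhaseQ

variable (P : PhaseQ)

/-- **Junction check of a phase**: an `identical` junction has equal element data, a `forms`
junction passes the junction test. [folklore] -/
def agreeB (P : PhaseQ) : Bool :=
  (List.range P.K).all fun j => !decide (j + 1 < P.K) ||
    match (P.node j).ann.jkind with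
    | .identical => decide ((P.node j).e = (P.node (j + 1)).e)
    | .forms mT mΞ mT' mΞ' za zb za' zb' => ElemQ.agreeJB (P.node j).e (P.node (j + 1)).e mT mΞ mT' mΞ' za zb za' zb'

variable {P}

/-- A slab functional pair certifies the abscissa interval. [folklore] -/
theorem uOf_mem_of_slabFuns {e : ElemQ} {za zb : Aff} {α : ℝ} {z : E²}
    (h : ∀ φ ∈ slabFuns e za zb, φ.eval α z < 0) : e.uOf z ∈ Icc (za.eval α) (zb.eval α) := by
  have h1 := h ⟨-e.uC.1, -e.uC.2, za⟩ (by simp [slabFuns])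
  have h2 := h ⟨e.uC.1, e.uC.2, Aff.smul (-1) zb⟩ (by simp [slabFuns])
  simp only [LinFun.eval, Aff.eval_smul] at h1 h2
  push_cast at h1 h2
  simp only [ElemQ.uOf]
  constructor <;> linarith

/-- **The fields of consecutive elements agree on the agreement region** of a phase passing the
junction check. [folklore] -/
theorem fields_eq_of_agreeB (h : P.agreeB = true) (hv : P.elemsValidB = true) {G : ℝ → ℝ} (hGe : ∀ x, G (-x) = G x)
    {j : ℕ} (hj : j + 1 < P.K)
    {p : ℝ × E²} (hp : p ∈ P.Agree j) :
    P.Θ G (j + 1) p.1 p.2 = P.Θ G j p.1 p.2 ∧ P.H (j + 1) p.1 p.2 = P.H j p.1 p.2 := by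
  have hj' : j < P.K := by omega
  have hall := List.all_eq_true.1 h j (List.mem_range.2 hj')
  simp only [hj, decide_true, Bool.not_true, Bool.false_or] at hall
  have hvj := validB_node hv hj'
  have hvj1 := validB_node hv hj
  simp only [PhaseQ.Θ, PhaseQ.H]
  simp only [Agree, agreeFuns, Set.mem_setOf_eq] at hp
  cases hk : (P.node j).ann.jkind with
  | identical =>
    rw [hk] at hall
    simp only [decide_eq_true_eq] at hall
    rw [hall]; exact ⟨rfl, rfl⟩
  | forms mT mΞ mT' mΞ' za zb za' zb' =>
    rw [hk] at hall hp
    simp only at hall hp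
    have hu : (P.node j).e.uOf p.2 ∈ Icc (za.eval (clock P.T0 P.Tau p.1)) (zb.eval (clock P.T0 P.Tau p.1)) :=
      uOf_mem_of_slabFuns fun φ hφ => hp φ (List.mem_append_left _ hφ)
    have hu' : (P.node (j + 1)).e.uOf p.2 ∈ Icc (za'.eval (clock P.T0 P.Tau p.1)) (zb'.eval (clock P.T0 P.Tau p.1)) :=
      uOf_mem_of_slabFuns fun φ hφ => hp φ (List.mem_append_right _ hφ)
    exact ⟨(ElemQ.scalar_eq_of_agreeJB hall hvj hvj1 hGe hu hu').symm, (ElemQ.stream_eq_of_agreeJB hall hvj hvj1 hu hu').symm⟩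

/-- **Agreement of a phase** passing the junction check. [folklore] -/
theorem agreement_of_agreeB (h : P.agreeB = true) (hv : P.elemsValidB = true) {G : ℝ → ℝ} (hGe : ∀ x, G (-x) = G x) :
    P.chain.Agreement (P.Θ G) P.H P.Agree where
  isOpen j _ := P.isOpen_Agree j
  scalar _ hj _ hp := (fields_eq_of_agreeB h hv hGe hj hp).1
  stream _ hj _ hp := (fields_eq_of_agreeB h hv hGe hj hp).2

end PhaseQ

/-! ## The interior facts of a checked phase

A phase passing its three finite checks (`geomB`, `boxSepB`, `agreeB`) with an even, smooth, bounded
profile supported in `(-r₀, r₀)` has, on all times and the closed unit square: the transport of its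
assembled scalar by its assembled velocity, the bound `|Θ| ≤ M`, and the junction agreement of its
scalars on the cut junctions (the hypothesis `JAgree` of the re-description theorem). Smoothness and
incompressibility hold everywhere (`PhaseQ.contDiff_uncurry_scalar/velocity`, `divergence_velocity`). -/

namespace PhaseQ

variable {P : PhaseQ}

/-- Validity from the geometric check. [folklore] -/
theorem elemsValidB_of_geomB (hg : P.geomB = true) : P.elemsValidB = true := by
  simp only [geomB, Bool.and_eq_true] at hg; exact hg.1.1

/-- **Transport on all times and the closed square** for a checked phase. [folklore] -/
theorem transport_of_checks {G : ℝ → ℝ} {M : ℝ} (hG : ContDiff ℝ ∞ G) (hM : ∀ q, |G q| ≤ M) (hM0 : 0 ≤ M)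
    (hG0 : ∀ q, G q ≠ 0 → |q| < P.r₀) (hGe : ∀ x, G (-x) = G x)
    (hg : P.geomB = true) (hsep : P.boxSepB = true) (ha : P.agreeB = true) (t : ℝ) {z : E²} (hz : ∀ j, 0 ≤ z j ∧ z j ≤ 1) :
    deriv (fun s => P.scalar G s z) t + fderiv ℝ (P.scalar G t) z (P.velocity t z) = 0 := by
  have hv := elemsValidB_of_geomB hg
  exact (wfbd_of_geomB hg hsep).transport_move (S := Set.univ) (Q := {z : E² | ∀ j, 0 ≤ z j ∧ z j ≤ 1}) (H₀ := 0)
    (P.facts hG hM hM0 hG0 hv) (agreement_of_agreeB ha hv hGe)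
    (fun t _ z hz k hk hp => cover_of_geomB hg t hz hk hp) t (Set.mem_univ t) z hz

/-- **The bound `|Θ| ≤ M` on all times and the closed square** for a checked phase. [folklore] -/
theorem abs_scalar_le_of_checks {G : ℝ → ℝ} {M : ℝ} (hG : ContDiff ℝ ∞ G) (hM : ∀ q, |G q| ≤ M) (hM0 : 0 ≤ M)
    (hG0 : ∀ q, G q ≠ 0 → |q| < P.r₀) (hGe : ∀ x, G (-x) = G x)
    (hg : P.geomB = true) (hsep : P.boxSepB = true) (ha : P.agreeB = true) (t : ℝ) {z : E²} (hz : ∀ j, 0 ≤ z j ∧ z j ≤ 1) :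
    |P.scalar G t z| ≤ M := by
  have hv := elemsValidB_of_geomB hg
  exact (wfbd_of_geomB hg hsep).abs_scalar_le (S := Set.univ) (Q := {z : E² | ∀ j, 0 ≤ z j ∧ z j ≤ 1})
    (P.facts hG hM hM0 hG0 hv) (agreement_of_agreeB ha hv hGe)
    (fun t _ z hz k hk hp => cover_of_geomB hg t hz hk hp) t (Set.mem_univ t) z hz

/-- **Junction agreement of the scalars on the cut junctions** (the `JAgree` hypothesis of the
re-description theorem) for a phase passing the junction check. [folklore] -/
theorem scalar_juncCut_of_agreeB {G : ℝ → ℝ} (hGe : ∀ x, G (-x) = G x) (ha : P.agreeB = true) (hv : P.elemsValidB = true) :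
    ∀ k, k + 1 < P.K → ∀ p ∈ P.chain.juncCut k ∩ P.Agree k, P.Θ G (k + 1) p.1 p.2 = P.Θ G k p.1 p.2 :=
  fun _ hk _ hp => (fields_eq_of_agreeB ha hv hGe hk hp.2).1

/-- **Both fields vanish off the current support boxes** (all times). [folklore] -/
theorem fields_eq_zero_off_boxes {G : ℝ → ℝ} (hg : P.geomB = true) (hsep : P.boxSepB = true) {t : ℝ} {z : E²}
    (hz : ∀ k < P.K, z ∉ ((P.node k).box.frzAt (clock P.T0 P.Tau t)).supp) :
    P.scalar G t z = 0 ∧ P.velocity t z = 0 :=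
  ⟨(wfbd_of_geomB hg hsep).scalar_eq_zero_off_boxes hz, (wfbd_of_geomB hg hsep).velocity_eq_zero_off_boxes hz⟩

end PhaseQ

end PlanarKinematics

end Literature.Analysis.FluidPDE
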